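import Mathlib
import HarnessLib

/-!
# THE `k`-ARM HOMOGENEITY STATISTIC VERSUS THE PAIRWISE `σ_comb` CRITERIA:
# `max_{r≠r'} (x_r − x_{r'})²/(v_r + v_{r'}) ≤ Q ≤ ½ Σ_{r,r'} (x_r − x_{r'})²/(v_r + v_{r'})`

HONEST FRAMING: exact (Metropolis-corrected) sampling algorithms for lattice gauge theory;
figures of merit are autocorrelation/cost numbers at stated couplings and volumes; no
continuum-physics claim.

Venture `LatticeQCDFlow` (cell pub-lqcd), topic `Scoring`; FANOUT row 4 (`s0-u1-b`, GEN-33).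
NEW WORK of the cell (elementary algebra), no definition, nothing cited as a fact.  Mathlib only.

WHY (row 4).  The row scores several implementations of one sampler in two ways: PAIRWISE, "`A` vs
`B` within `q·σ_comb`", i.e. `|x_r − x_{r'}| ≤ q·√(v_r + v_{r'})` (calibrated and powered in
`Scoring/AsymptoticCoverage`, `Scoring/AgreementTestPower`, …), and ONE-SHOT, by the
inverse-variance homogeneity statistic
`Q(x, v) = Σ_r (x_r − m̂)²/v_r`, `m̂ = (Σ_j x_j/v_j)/(Σ_j v_j⁻¹)`
(`Scoring/GaussianCochranReduction`, `Scoring/KArmHomogeneityPower`).  This file relates the two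
DETERMINISTICALLY, for arbitrary reals `x_r` and `v_r > 0`:

* Steiner: `Σ_r (x_r − μ)²/v_r = Q + (Σ_j v_j⁻¹)(μ − m̂)²` for every `μ`; hence `Q ≤ Σ_r (x_r − μ)²/v_r`
  (with `μ` the common true value this bounds `Q` by a sum of `R` independent unit-variance squares
  — a Cochran-free conservative calibration);
* the pairwise form `Σ_r Σ_{r'} (x_r − x_{r'})²/(v_r v_{r'}) = 2 (Σ_j v_j⁻¹) Q`, and for two arms
  EXACTLY `Q = (x₀ − x₁)²/(v₀ + v₁)`: the `2`-arm homogeneity test at `q²` IS the `σ_comb` test at `q`;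
* **lower bound** `(x_r − x_{r'})²/(v_r + v_{r'}) ≤ Q` (`r ≠ r'`): if `Q ≤ q²` then EVERY pair passes
  the `σ_comb` test at `q`;
* **upper bound** `Q ≤ ½ Σ_r Σ_{r'} (x_r − x_{r'})²/(v_r + v_{r'})`: if every pair passes at `q` then
  `Q ≤ (R(R−1)/2)·q²`;
* the same three facts as inclusions of events on an arbitrary sample space (for `measure_mono`).

## Content

* `weighted_sum_sq_sub_eq`, `sum_sum_weighted_sq_sub` (§1, weights `w_r`, any `m` with
  `(Σ w) m = Σ w x`);
* `sum_inv_mul_invVarMean`, `homogeneity_statistic_steiner`, `homogeneity_statistic_le_sum_sq_div`,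
  `homogeneity_statistic_pairwise`, `homogeneity_statistic_fin_two` (§2);
* **`sq_sub_div_add_le_homogeneity_statistic`**, **`homogeneity_statistic_le_half_sum_sum`**,
  `abs_sub_le_of_homogeneity_statistic_le`, `homogeneity_statistic_le_of_pairwise` (§3);
* `setOf_homogeneity_le_subset_iInter`, `iInter_pairwise_subset_setOf_homogeneity_le`,
  `setOf_sum_sq_div_le_subset` (§4).

NOT CLAIMED: anything probabilistic (the calibration of either criterion is elsewhere).
-/

open Finset

namespace Summit.Ventures.LatticeQCDFlow.Scoring

/-! ## §1 Weighted sums of squares: Steiner and the pairwise identity -/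

section Weighted

variable {R : ℕ}

/-- **Steiner's identity for weighted sums of squares**: if `(Σ_j w_j)·m = Σ_j w_j x_j` then
`Σ_r w_r (x_r − μ)² = Σ_r w_r (x_r − m)² + (Σ_j w_j)(μ − m)²` for every `μ`. [ours] -/
theorem weighted_sum_sq_sub_eq (w x : Fin R → ℝ) {m : ℝ} (hm : (∑ j, w j) * m = ∑ j, w j * x j)
    (μ : ℝ) :
    ∑ r, w r * (x r - μ) ^ 2 = ∑ r, w r * (x r - m) ^ 2 + (∑ j, w j) * (μ - m) ^ 2 := by
  have hexpand : ∀ c : ℝ, ∑ r, w r * (x r - c) ^ 2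
      = (∑ r, w r * x r ^ 2) - 2 * c * (∑ r, w r * x r) + c ^ 2 * ∑ r, w r := by
    intro c
    simp only [Finset.mul_sum, ← Finset.sum_sub_distrib, ← Finset.sum_add_distrib]
    exact Finset.sum_congr rfl fun r _ => by ring
  rw [hexpand μ, hexpand m]
  linear_combination (2 * (μ - m)) * hm

/-- **The pairwise form of a weighted sum of squares**: if `(Σ_j w_j)·m = Σ_j w_j x_j` then
`Σ_r Σ_{r'} w_r w_{r'} (x_r − x_{r'})² = 2 (Σ_j w_j) Σ_r w_r (x_r − m)²`. [ours] -/
theorem sum_sum_weighted_sq_sub (w x : Fin R → ℝ) {m : ℝ} (hm : (∑ j, w j) * m = ∑ j, w j * x j) :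
    ∑ r, ∑ r', w r * w r' * (x r - x r') ^ 2 = 2 * (∑ j, w j) * ∑ r, w r * (x r - m) ^ 2 := by
  have h : ∀ r, ∑ r', w r * w r' * (x r - x r') ^ 2
      = w r * (∑ r', w r' * (x r' - m) ^ 2) + (∑ j, w j) * (w r * (x r - m) ^ 2) := by
    intro r
    have h1 : ∑ r', w r * w r' * (x r - x r') ^ 2 = w r * ∑ r', w r' * (x r' - x r) ^ 2 := by
      rw [Finset.mul_sum]
      exact Finset.sum_congr rfl fun r' _ => by ring
    rw [h1, weighted_sum_sq_sub_eq w x hm (x r)]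
    ring
  rw [Finset.sum_congr rfl fun r _ => h r, Finset.sum_add_distrib, ← Finset.sum_mul,
    ← Finset.mul_sum]
  ring

end Weighted

/-! ## §2 The inverse-variance homogeneity statistic -/

section Statistic

variable {R : ℕ}

/-- The inverse-variance weighted mean `m̂ = (Σ_j x_j/v_j)/(Σ_j v_j⁻¹)` satisfies
`(Σ_j v_j⁻¹)·m̂ = Σ_j v_j⁻¹ x_j` (`v_j > 0`; trivially also for `R = 0`). [ours] -/
theorem sum_inv_mul_invVarMean (x v : Fin R → ℝ) (hv : ∀ r, 0 < v r) :
    (∑ j, (v j)⁻¹) * ((∑ j, x j / v j) / ∑ j, (v j)⁻¹) = ∑ j, (v j)⁻¹ * x j := by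
  rcases isEmpty_or_nonempty (Fin R) with hR | hR
  · simp
  have hW : 0 < ∑ j, (v j)⁻¹ := Finset.sum_pos (fun j _ => inv_pos.2 (hv j)) Finset.univ_nonempty
  rw [mul_div_cancel₀ _ hW.ne']
  exact Finset.sum_congr rfl fun j _ => by rw [div_eq_inv_mul]

/-- **Steiner for the homogeneity statistic**: for `v_r > 0` and every `μ`,
`Σ_r (x_r − μ)²/v_r = Σ_r (x_r − m̂)²/v_r + (Σ_j v_j⁻¹)(μ − m̂)²`. [ours] -/
theorem homogeneity_statistic_steiner (x v : Fin R → ℝ) (hv : ∀ r, 0 < v r) (μ : ℝ) :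
    ∑ r, (x r - μ) ^ 2 / v r
      = ∑ r, (x r - (∑ j, x j / v j) / (∑ j, (v j)⁻¹)) ^ 2 / v r
        + (∑ j, (v j)⁻¹) * (μ - (∑ j, x j / v j) / (∑ j, (v j)⁻¹)) ^ 2 := by
  have h := weighted_sum_sq_sub_eq (fun r => (v r)⁻¹) x (sum_inv_mul_invVarMean x v hv) μ
  simpa only [div_eq_inv_mul] using h

/-- **`m̂` minimises**: `Σ_r (x_r − m̂)²/v_r ≤ Σ_r (x_r − μ)²/v_r` for every `μ` (`v_r > 0`).  With `μ`
the common true value the right-hand side is a sum of `R` unit-variance squares. [ours] -/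
theorem homogeneity_statistic_le_sum_sq_div (x v : Fin R → ℝ) (hv : ∀ r, 0 < v r) (μ : ℝ) :
    ∑ r, (x r - (∑ j, x j / v j) / (∑ j, (v j)⁻¹)) ^ 2 / v r ≤ ∑ r, (x r - μ) ^ 2 / v r := by
  rw [homogeneity_statistic_steiner x v hv μ]
  exact le_add_of_nonneg_right
    (mul_nonneg (Finset.sum_nonneg fun j _ => (inv_pos.2 (hv j)).le) (sq_nonneg _))

/-- **Pairwise form**: `Σ_r Σ_{r'} (x_r − x_{r'})²/(v_r v_{r'}) = 2 (Σ_j v_j⁻¹) Σ_r (x_r − m̂)²/v_r`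
(`v_r > 0`). [ours] -/
theorem homogeneity_statistic_pairwise (x v : Fin R → ℝ) (hv : ∀ r, 0 < v r) :
    ∑ r, ∑ r', (x r - x r') ^ 2 / (v r * v r')
      = 2 * (∑ j, (v j)⁻¹) * ∑ r, (x r - (∑ j, x j / v j) / (∑ j, (v j)⁻¹)) ^ 2 / v r := by
  have h := sum_sum_weighted_sq_sub (fun r => (v r)⁻¹) x (sum_inv_mul_invVarMean x v hv)
  simpa only [div_eq_inv_mul, mul_inv, mul_assoc] using h

/-- **Two arms**: `Σ_{r<2} (x_r − m̂)²/v_r = (x₀ − x₁)²/(v₀ + v₁)` — the `2`-arm homogeneity statistic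
IS the squared `σ_comb`-studentised difference. [ours] -/
theorem homogeneity_statistic_fin_two (x v : Fin 2 → ℝ) (hv : ∀ r, 0 < v r) :
    ∑ r, (x r - (∑ j, x j / v j) / (∑ j, (v j)⁻¹)) ^ 2 / v r = (x 0 - x 1) ^ 2 / (v 0 + v 1) := by
  have h0 := (hv 0).ne'
  have h1 := (hv 1).ne'
  have hs : v 0 + v 1 ≠ 0 := (add_pos (hv 0) (hv 1)).ne'
  have hs' : v 1 + v 0 ≠ 0 := (add_pos (hv 1) (hv 0)).ne'
  simp only [Fin.sum_univ_two]
  rw [eq_div_iff hs]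
  field_simp
  ring

end Statistic

/-! ## §3 The two-sided comparison with the pairwise criteria -/

section Comparison

variable {R : ℕ}

/-- **Lower bound — the homogeneity statistic dominates every pairwise statistic**: for `v_r > 0`
and `r₁ ≠ r₂`, `(x_{r₁} − x_{r₂})²/(v_{r₁} + v_{r₂}) ≤ Σ_r (x_r − m̂)²/v_r`. [ours]
(Two terms of the sum already dominate: `(u − t)² v₁v₂ ≤ (u² v₂ + t² v₁)(v₁ + v₂)`.) -/
theorem sq_sub_div_add_le_homogeneity_statistic (x v : Fin R → ℝ) (hv : ∀ r, 0 < v r)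
    {r₁ r₂ : Fin R} (hne : r₁ ≠ r₂) :
    (x r₁ - x r₂) ^ 2 / (v r₁ + v r₂)
      ≤ ∑ r, (x r - (∑ j, x j / v j) / (∑ j, (v j)⁻¹)) ^ 2 / v r := by
  set m := (∑ j, x j / v j) / (∑ j, (v j)⁻¹) with hm
  have hterm : ∀ r, 0 ≤ (x r - m) ^ 2 / v r := fun r => div_nonneg (sq_nonneg _) (hv r).le
  have h2 : (x r₁ - m) ^ 2 / v r₁ + (x r₂ - m) ^ 2 / v r₂ ≤ ∑ r, (x r - m) ^ 2 / v r := by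
    rw [← Finset.sum_pair (f := fun r => (x r - m) ^ 2 / v r) hne]
    exact Finset.sum_le_sum_of_subset_of_nonneg (Finset.subset_univ _) fun r _ _ => hterm r
  refine le_trans ?_ h2
  have ha := hv r₁
  have hb := hv r₂
  rw [div_add_div _ _ ha.ne' hb.ne', div_le_div_iff₀ (add_pos ha hb) (mul_pos ha hb)]
  nlinarith [sq_nonneg (v r₂ * (x r₁ - m) + v r₁ * (x r₂ - m)), ha, hb]

/-- **Upper bound**: for `v_r > 0`,
`Σ_r (x_r − m̂)²/v_r ≤ ½ Σ_r Σ_{r'} (x_r − x_{r'})²/(v_r + v_{r'})` (diagonal terms vanish).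
[ours] (Pairwise form and `v_r v_{r'} Σ_j v_j⁻¹ ≥ v_r + v_{r'}` for `r ≠ r'`.) -/
theorem homogeneity_statistic_le_half_sum_sum (x v : Fin R → ℝ) (hv : ∀ r, 0 < v r) :
    ∑ r, (x r - (∑ j, x j / v j) / (∑ j, (v j)⁻¹)) ^ 2 / v r
      ≤ (∑ r, ∑ r', (x r - x r') ^ 2 / (v r + v r')) / 2 := by
  rcases isEmpty_or_nonempty (Fin R) with hR | hR
  · simp
  have hpair := homogeneity_statistic_pairwise x v hv
  set W := ∑ j, (v j)⁻¹ with hW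
  have hWpos : 0 < W := Finset.sum_pos (fun j _ => inv_pos.2 (hv j)) Finset.univ_nonempty
  set Q := ∑ r, (x r - (∑ j, x j / v j) / W) ^ 2 / v r with hQ
  -- termwise comparison
  have hterm : ∀ r r', (x r - x r') ^ 2 / (v r * v r') ≤ W * ((x r - x r') ^ 2 / (v r + v r')) := by
    intro r r'
    rcases eq_or_ne r r' with h | h
    · subst h
      simp
    · have hvv : (v r)⁻¹ + (v r')⁻¹ ≤ W := by
        rw [hW, ← Finset.sum_pair (f := fun j => (v j)⁻¹) h]
        exact Finset.sum_le_sum_of_subset_of_nonneg (Finset.subset_univ _)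
          fun j _ _ => (inv_pos.2 (hv j)).le
      have hs : 0 < v r + v r' := add_pos (hv r) (hv r')
      have hvr := (hv r).ne'
      have hvr' := (hv r').ne'
      calc (x r - x r') ^ 2 / (v r * v r')
          = (x r - x r') ^ 2 * (((v r)⁻¹ + (v r')⁻¹) / (v r + v r')) := by
            rw [inv_add_inv hvr hvr', div_div_cancel_left' hs.ne', div_eq_mul_inv]
        _ ≤ (x r - x r') ^ 2 * (W / (v r + v r')) := by gcongr
        _ = W * ((x r - x r') ^ 2 / (v r + v r')) := by ring
  have hsum : ∑ r, ∑ r', (x r - x r') ^ 2 / (v r * v r')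
      ≤ W * ∑ r, ∑ r', (x r - x r') ^ 2 / (v r + v r') := by
    rw [Finset.mul_sum]
    refine Finset.sum_le_sum fun r _ => ?_
    rw [Finset.mul_sum]
    exact Finset.sum_le_sum fun r' _ => hterm r r'
  rw [hpair] at hsum
  have h2 : W * (2 * Q) ≤ W * ∑ r, ∑ r', (x r - x r') ^ 2 / (v r + v r') := by
    calc W * (2 * Q) = 2 * W * Q := by ring
      _ ≤ _ := hsum
  have h3 := le_of_mul_le_mul_left h2 hWpos
  rw [le_div_iff₀ two_pos]
  linarith

/-- **One-shot pass ⇒ every pairwise pass**: if `Σ_r (x_r − m̂)²/v_r ≤ q²` (`q ≥ 0`, `v_r > 0`) then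
`|x_{r₁} − x_{r₂}| ≤ q·√(v_{r₁} + v_{r₂})` for every `r₁ ≠ r₂`. [ours] -/
theorem abs_sub_le_of_homogeneity_statistic_le (x v : Fin R → ℝ) (hv : ∀ r, 0 < v r)
    {r₁ r₂ : Fin R} (hne : r₁ ≠ r₂) {q : ℝ} (hq : 0 ≤ q)
    (hQ : ∑ r, (x r - (∑ j, x j / v j) / (∑ j, (v j)⁻¹)) ^ 2 / v r ≤ q ^ 2) :
    |x r₁ - x r₂| ≤ q * √(v r₁ + v r₂) := by
  have hs : 0 < v r₁ + v r₂ := add_pos (hv r₁) (hv r₂)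
  have h := (sq_sub_div_add_le_homogeneity_statistic x v hv hne).trans hQ
  rw [div_le_iff₀ hs] at h
  rw [← Real.sqrt_sq_eq_abs, show q * √(v r₁ + v r₂) = √(q ^ 2 * (v r₁ + v r₂)) by
    rw [Real.sqrt_mul (sq_nonneg q), Real.sqrt_sq hq]]
  exact Real.sqrt_le_sqrt h

/-- **Every pairwise pass ⇒ a one-shot bound**: if `|x_r − x_{r'}| ≤ q·√(v_r + v_{r'})` for all
`r, r'` (`v_r > 0`) then `Σ_r (x_r − m̂)²/v_r ≤ (R(R−1)/2)·q²`. [ours] -/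
theorem homogeneity_statistic_le_of_pairwise (x v : Fin R → ℝ) (hv : ∀ r, 0 < v r) {q : ℝ}
    (hpass : ∀ r r', |x r - x r'| ≤ q * √(v r + v r')) :
    ∑ r, (x r - (∑ j, x j / v j) / (∑ j, (v j)⁻¹)) ^ 2 / v r ≤ ((R : ℝ) * ((R : ℝ) - 1) / 2) * q ^ 2 := by
  have hterm : ∀ r r', (x r - x r') ^ 2 / (v r + v r') ≤ q ^ 2 := by
    intro r r'
    have hs : 0 < v r + v r' := add_pos (hv r) (hv r')
    rw [div_le_iff₀ hs]
    have h := hpass r r'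
    calc (x r - x r') ^ 2 = |x r - x r'| ^ 2 := (sq_abs _).symm
      _ ≤ (q * √(v r + v r')) ^ 2 := pow_le_pow_left₀ (abs_nonneg _) h 2
      _ = q ^ 2 * (v r + v r') := by rw [mul_pow, Real.sq_sqrt hs.le]
  have hrow : ∀ r : Fin R, ∑ r', (x r - x r') ^ 2 / (v r + v r') ≤ ((R : ℝ) - 1) * q ^ 2 := by
    intro r
    have h0 : (x r - x r) ^ 2 / (v r + v r) = 0 := by simp
    have hR : 1 ≤ R := Nat.succ_le_of_lt (Fin.pos r)
    calc ∑ r', (x r - x r') ^ 2 / (v r + v r')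
        = ∑ r' ∈ Finset.univ.erase r, (x r - x r') ^ 2 / (v r + v r') :=
          (Finset.sum_erase (f := fun r' => (x r - x r') ^ 2 / (v r + v r')) _ h0).symm
      _ ≤ ∑ r' ∈ Finset.univ.erase r, q ^ 2 := Finset.sum_le_sum fun r' _ => hterm r r'
      _ = ((R : ℝ) - 1) * q ^ 2 := by
          rw [Finset.sum_const, nsmul_eq_mul, Finset.card_erase_of_mem (Finset.mem_univ r),
            Finset.card_univ, Fintype.card_fin, Nat.cast_sub hR, Nat.cast_one]
  have htot : ∑ r, ∑ r', (x r - x r') ^ 2 / (v r + v r') ≤ (R : ℝ) * (((R : ℝ) - 1) * q ^ 2) := by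
    calc ∑ r, ∑ r', (x r - x r') ^ 2 / (v r + v r')
        ≤ ∑ _r : Fin R, ((R : ℝ) - 1) * q ^ 2 := Finset.sum_le_sum fun r _ => hrow r
      _ = (R : ℝ) * (((R : ℝ) - 1) * q ^ 2) := by
          rw [Finset.sum_const, Finset.card_univ, Fintype.card_fin, nsmul_eq_mul]
  calc ∑ r, (x r - (∑ j, x j / v j) / (∑ j, (v j)⁻¹)) ^ 2 / v r
      ≤ (∑ r, ∑ r', (x r - x r') ^ 2 / (v r + v r')) / 2 :=
        homogeneity_statistic_le_half_sum_sum x v hv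
    _ ≤ ((R : ℝ) * (((R : ℝ) - 1) * q ^ 2)) / 2 := by gcongr
    _ = ((R : ℝ) * ((R : ℝ) - 1) / 2) * q ^ 2 := by ring

end Comparison

/-! ## §4 The same as inclusions of events -/

section Events

variable {R : ℕ} {Ω : Type*}

/-- `{Q ≤ q²} ⊆ ⋂_{r≠r'} {|X_r − X_{r'}| ≤ q√(V_r + V_{r'})}` pointwise on any sample space
(`q ≥ 0`, `V_r > 0`). [ours] -/
theorem setOf_homogeneity_le_subset_iInter (X V : Ω → Fin R → ℝ) (hV : ∀ ω r, 0 < V ω r)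
    {q : ℝ} (hq : 0 ≤ q) :
    {ω | ∑ r, (X ω r - (∑ j, X ω j / V ω j) / (∑ j, (V ω j)⁻¹)) ^ 2 / V ω r ≤ q ^ 2}
      ⊆ ⋂ (r₁ : Fin R) (r₂ : Fin R) (_ : r₁ ≠ r₂),
          {ω | |X ω r₁ - X ω r₂| ≤ q * √(V ω r₁ + V ω r₂)} := by
  intro ω hω
  simp only [Set.mem_iInter, Set.mem_setOf_eq]
  intro r₁ r₂ hne
  exact abs_sub_le_of_homogeneity_statistic_le (X ω) (V ω) (hV ω) hne hq hω

/-- `⋂_{r,r'} {|X_r − X_{r'}| ≤ q√(V_r + V_{r'})} ⊆ {Q ≤ (R(R−1)/2) q²}` pointwise on any sample space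
(`V_r > 0`). [ours] -/
theorem iInter_pairwise_subset_setOf_homogeneity_le (X V : Ω → Fin R → ℝ) (hV : ∀ ω r, 0 < V ω r)
    (q : ℝ) :
    (⋂ (r₁ : Fin R) (r₂ : Fin R), {ω | |X ω r₁ - X ω r₂| ≤ q * √(V ω r₁ + V ω r₂)})
      ⊆ {ω | ∑ r, (X ω r - (∑ j, X ω j / V ω j) / (∑ j, (V ω j)⁻¹)) ^ 2 / V ω r
          ≤ ((R : ℝ) * ((R : ℝ) - 1) / 2) * q ^ 2} := by
  intro ω hω
  simp only [Set.mem_iInter, Set.mem_setOf_eq] at hω ⊢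
  exact homogeneity_statistic_le_of_pairwise (X ω) (V ω) (hV ω) fun r r' => hω r r'

/-- `{Σ_r (X_r − μ)²/V_r ≤ c} ⊆ {Q ≤ c}` pointwise on any sample space, for every `μ` (`V_r > 0`):
the conservative `R`-squares calibration event is inside the one-shot pass event. [ours] -/
theorem setOf_sum_sq_div_le_subset (X V : Ω → Fin R → ℝ) (hV : ∀ ω r, 0 < V ω r) (μ c : ℝ) :
    {ω | ∑ r, (X ω r - μ) ^ 2 / V ω r ≤ c}
      ⊆ {ω | ∑ r, (X ω r - (∑ j, X ω j / V ω j) / (∑ j, (V ω j)⁻¹)) ^ 2 / V ω r ≤ c} :=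
  fun ω hω => (homogeneity_statistic_le_sum_sq_div (X ω) (V ω) (hV ω) μ).trans hω

end Events

end Summit.Ventures.LatticeQCDFlow.Scoring
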